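import Mathlib
import Summits.NavierStokesRegularity.NavierStokesRegularity.Theorems.FilamentSkeletonRssSkeletonJ1RLiaSelfDerivWindow
import Summits.NavierStokesRegularity.NavierStokesRegularity.Theorems.FilamentSkeletonRssSkeletonJ1RLiaSelfEnvelope

/-!
# Crux `SkeletonJ1R` (stmt-NavierStokesRegularity-23610) · line `streamline_kantorovich_R` · toward stub F2-d (`LiaDefectDerivBL`, v7), brick S3′ (window zone) for B1′:
# THE WINDOW-ZONE MAJORANT OF THE SYMMETRIZED SELF-STRAND DERIVATIVE INTEGRAND for a curve with a LINEAR curvature envelope and `C³` window data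

Hand `leafhand-ns-filamentskeletonrs-1` (gen 0), `--supports stmt-NavierStokesRegularity-23610 --as helper`.  MODEL rung, NEGATIVE side of the ladder:
kernel calculus for a HYPOTHETICAL filament-type blow-up skeleton; nothing here is a claim about Navier–Stokes regularity; the stub and the crux stay OPEN.

Derivative analogue of zone 1 of brick S3 (`…LiaSelfEnvelope.majorant_zone_window`): for `|σ − τ| ≤ R` and a unit-speed `C²` curve with envelope
`‖X″σ‖ ≤ ε₀ + ε₁|σ|`, which on the window `|p − τ| ≤ R` is `C³` (`X″` has derivative `Z` with `‖Z‖ ≤ H`, `‖Zp − Zτ‖ ≤ H′|p − τ|`), `κ_R ≥ ε₀ + ε₁(|τ|+R)`,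
`κ_R R ≤ 1`:  `‖D(σ) − K_e(σ−τ)((σ−τ)²/2)•X′τ×Zτ‖ ≤ 8H′ + 84κ_R H + 8(κ_R R)²H·K_e(σ−τ)(σ−τ)²/2` (`majorant_zone_window_deriv`) — the inner brick S2′
(`…LiaSelfDerivWindow.norm_symmDerivIntegrand_sub_windowModel_le`) with segment curvature `κ_R`, local chord constant `η = (κ_R R)²/2` and the Lipschitz
bound of `X″` about `σ` obtained from `‖Z‖ ≤ H` by the mean-value inequality.  With `…LiaSelfDerivOuterZones` (zones 2′–3′) and `…LiaSelfDerivFrame` the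
pointwise input of S3′ is complete.
-/

set_option linter.dupNamespace false -- `NavierStokesRegularity.NavierStokesRegularity` path/namespace repetition is the tree convention

noncomputable section

namespace Summit.NavierStokesRegularity.NavierStokesRegularity.Theorems.SkeletonJ1RLiaSelf

open Set Function Filter Real Topology MeasureTheory
open Literature.Analysis.FluidPDE
open scoped InnerProductSpace BigOperators

variable {X : ℝ → EuclideanSpace ℝ (Fin 3)}

/-- **Zone 1′ (log window `|σ − τ| ≤ R`) for the derivative integrand.** [folklore] -/
theorem majorant_zone_window_deriv (hX : ContDiff ℝ 2 X) (hunit : ∀ s, ‖deriv X s‖ = 1) {e : ℝ} (he : 0 < e)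
    {τ σ R ε₀ ε₁ H H' κR : ℝ} {Z : ℝ → EuclideanSpace ℝ (Fin 3)} (hε₁ : 0 ≤ ε₁) (henv : ∀ σ, ‖deriv (deriv X) σ‖ ≤ ε₀ + ε₁ * |σ|)
    (hH0 : 0 ≤ H) (hH'0 : 0 ≤ H')
    (hZ : ∀ p, |p - τ| ≤ R → HasDerivAt (deriv (deriv X)) (Z p) p) (hZH : ∀ p, |p - τ| ≤ R → ‖Z p‖ ≤ H)
    (hZlip : ∀ p, |p - τ| ≤ R → ‖Z p - Z τ‖ ≤ H' * |p - τ|)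
    (hκR : ε₀ + ε₁ * (|τ| + R) ≤ κR) (hsmall : κR * R ≤ 1) (hσ : |σ - τ| ≤ R) :
    ‖((-3 * ⟪X τ - X σ, deriv X τ - deriv X σ⟫_ℝ * ((‖X τ - X σ‖ ^ 2 + e ^ 2) ^ (5 / 2 : ℝ))⁻¹) • cross (deriv X σ) (X τ - X σ) +
        ((‖X τ - X σ‖ ^ 2 + e ^ 2) ^ (3 / 2 : ℝ))⁻¹ • (cross (deriv X σ) (deriv X τ - deriv X σ) + cross (deriv (deriv X) σ) (X τ - X σ))) -
        (((((σ - τ) ^ 2 + e ^ 2) ^ (3 / 2 : ℝ))⁻¹ * ((σ - τ) ^ 2 / 2)) • cross (deriv X τ) (Z τ))‖ ≤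
      8 * H' + 84 * (κR * H) + 8 * (κR * R) ^ 2 * H * ((((σ - τ) ^ 2 + e ^ 2) ^ (3 / 2 : ℝ))⁻¹ * ((σ - τ) ^ 2 / 2)) := by
  have hR0 : 0 ≤ R := (abs_nonneg _).trans hσ
  have hκR0 : 0 ≤ κR := by
    have h := henv τ
    have : ε₀ + ε₁ * |τ| ≤ κR := by nlinarith [mul_nonneg hε₁ hR0]
    exact (norm_nonneg _).trans (h.trans this)
  -- the segment lies in the window
  have hsegW : ∀ p ∈ uIcc σ τ, |p - τ| ≤ R := fun p hp => ((abs_le_of_mem_uIcc (uIcc_comm σ τ ▸ hp)).1).trans hσ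
  -- segment curvature ≤ κR
  have hκ' : ∀ p ∈ uIcc τ σ, ‖deriv (deriv X) p‖ ≤ κR := fun p hp =>
    (curvature_le_on_segment hε₁ henv τ σ p hp).trans (by nlinarith [mul_le_mul_of_nonneg_left hσ hε₁])
  have hκ : ∀ p ∈ uIcc σ τ, ‖deriv (deriv X) p‖ ≤ κR := fun p hp => hκ' p (uIcc_comm σ τ ▸ hp)
  -- C³ data on the segment
  have hZseg : ∀ p ∈ uIcc σ τ, HasDerivAt (deriv (deriv X)) (Z p) p := fun p hp => hZ p (hsegW p hp)
  have hZlipseg : ∀ p ∈ uIcc σ τ, ‖Z p - Z τ‖ ≤ H' * |p - τ| := fun p hp => hZlip p (hsegW p hp)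
  have hZτ : ‖Z τ‖ ≤ H := hZH τ (by rw [sub_self, abs_zero]; exact hR0)
  -- X″ is H-Lipschitz about σ on the segment (mean value with ‖Z‖ ≤ H)
  have hHseg : ∀ q ∈ uIcc σ τ, ‖deriv (deriv X) q - deriv (deriv X) σ‖ ≤ H * |q - σ| := by
    intro q hq
    have h := Convex.norm_image_sub_le_of_norm_hasDerivWithin_le (f := deriv (deriv X)) (f' := Z)
      (fun p hp => (hZseg p hp).hasDerivWithinAt) (fun p hp => hZH p (hsegW p hp)) (convex_uIcc σ τ) left_mem_uIcc hq
    simpa [Real.norm_eq_abs] using h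
  -- local oscillation ≤ κR·R, hence chord ≥ (1 − η)|σ − τ| with η = (κR R)²/2
  have hoscl : ∀ p ∈ uIcc τ σ, ‖deriv X p - deriv X τ‖ ≤ κR * R := by
    intro p hp
    have hsub : uIcc τ p ⊆ uIcc τ σ := uIcc_subset_uIcc left_mem_uIcc hp
    have h1 := norm_deriv_sub_deriv_le_on hX (τ := τ) (σ := p) (κ := κR) fun q hq => hκ' q (hsub hq)
    exact h1.trans (mul_le_mul_of_nonneg_left (((abs_le_of_mem_uIcc hp).1).trans hσ) hκR0)
  have hchord := chord_ge_of_local_osc hX hunit hoscl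
  have hη0 : 0 ≤ (κR * R) ^ 2 / 2 := by positivity
  have hη1 : (κR * R) ^ 2 / 2 ≤ 1 / 2 := by
    have : (κR * R) ^ 2 ≤ 1 := by
      have h0 : 0 ≤ κR * R := mul_nonneg hκR0 hR0
      nlinarith
    linarith
  have h := norm_symmDerivIntegrand_sub_windowModel_le hX hunit he hκ hH0 hHseg hZseg hZτ hH'0 hZlipseg hη0 hη1 hchord
  calc _ ≤ 8 * H' + 84 * (κR * H) + 16 * ((κR * R) ^ 2 / 2) * H * ((((σ - τ) ^ 2 + e ^ 2) ^ (3 / 2 : ℝ))⁻¹ * ((σ - τ) ^ 2 / 2)) := h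
    _ = _ := by ring

end Summit.NavierStokesRegularity.NavierStokesRegularity.Theorems.SkeletonJ1RLiaSelf

end
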